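import Mathlib
import Literature.Barriers.ValiantsHypothesis.AlgebraicNaturalProofs
import Literature.Computability.AlgebraicComplexity.ArithCircuitProofs
import HarnessLib

/-!
# Crux `BarrierLever.SuccinctHittingSetsForVP` (stmt-ValiantsHypothesis-14610), line `registered` —
stub `stub_fullSupport`: A FULL-SUPPORT SMALL CIRCUIT

**What is proved (unconditional; a worker-sized stub of the sparse half, it does NOT close the
item).** In FSV's framework over `ℂ` (tree regime `d = n`, coefficient variables indexed by
`degLEMonomials n`, simple class `SmallCircuits ℂ n b = {f : deg f ≤ n, L(f) ≤ n^b}`):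

* `stub_fullSupport` : for every `n ≥ 2` there is `f₀ ∈ SmallCircuits ℂ n 3` ALL of whose
  `C(2n,n)` coefficients at the monomials of degree `≤ n` are nonzero.

The witness is `f₀ = (1 + x₁ + ⋯ + x_n) ^ n`: degree `≤ n`, fan-in-two size `≤ n (n + 2) ≤ n³`
(`n` additions for the linear form, `n` multiplications for the power), and its coefficient at
`x^m`, `|m| ≤ n`, is the multinomial `n! / (m! (n - |m|)!) ≥ 1`. This is the shift vector of
Forbes–Shpilka–Volk's Construction 29 (there the all-ones vector `coeff(∏ (x_i + 1))` of the
multilinear regime) transported to the regime `d = n`; the sparse half of the crux Taylor-shifts a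
sparse distinguisher to `coeff f₀`.

**Proof.** Positivity of the coefficients is proved over `ℕ` by induction on the exponent `k`:
`(1 + Σ x_i)^(k+1) = P + Σ_i P·x_i` with `P = (1 + Σ x_i)^k`, and
`coeff_m (P·x_i) = coeff_{m - e_i} P` for `i ∈ supp m` (`MvPolynomial.coeff_mul_X'`); a monomial
of degree `k + 1` has some `i` in its support and `|m - e_i| = k`. The statement is transferred to
`ℂ` along `MvPolynomial.map (Nat.castRingHom ℂ)` (`coeff_map`, characteristic zero). The size
bound uses `L(f + g), L(f g) ≤ L(f) + L(g) + 1`, `L(x_i) = L(c) = 0`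
(`Literature.Computability.AlgebraicComplexity`). Axioms: `propext`, `Classical.choice`,
`Quot.sound`.

References: [ForbesShpilkaVolk2018] Construction 29, Lemma 32, Cor. 34 (the role of the
full-support shift); [Burgisser2000] Def. 2.1, §2.1 (the complexity measure).
-/

-- layout Summits/ValiantsHypothesis/ValiantsHypothesis forces the duplicated namespace component
set_option linter.dupNamespace false

namespace Summit.ValiantsHypothesis.ValiantsHypothesis.Theorems.BarrierLever.SuccinctHittingSetsForVP

open Literature.Barriers.ValiantsHypothesis Literature.Computability.AlgebraicComplexity MvPolynomial

namespace FullSupport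

section Degree

variable {n : ℕ}

/-- `deg (1 + x₁ + ⋯ + x_n)^k ≤ k`. [folklore] -/
theorem totalDegree_linearForm_pow_le (k : ℕ) :
    ((1 + ∑ i : Fin n, X i : MvPolynomial (Fin n) ℂ) ^ k).totalDegree ≤ k := by
  refine (totalDegree_pow _ _).trans ?_
  have h : (1 + ∑ i : Fin n, X i : MvPolynomial (Fin n) ℂ).totalDegree ≤ 1 := by
    refine (totalDegree_add _ _).trans (max_le ?_ ?_)
    · rw [totalDegree_one]
      exact Nat.zero_le _
    · exact totalDegree_finsetSum_le fun i _ => (totalDegree_X (R := ℂ) i).le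
  calc k * (1 + ∑ i : Fin n, X i : MvPolynomial (Fin n) ℂ).totalDegree ≤ k * 1 :=
        Nat.mul_le_mul_left k h
    _ = k := mul_one k

end Degree

section Complexity

variable {n : ℕ}

/-- `L(u ^ k) ≤ k (L(u) + 1)`: repeated multiplication (`L(1) = 0`, one product gate per factor).
[cite: Burgisser2000, §2.1] -/
theorem complexity_pow_le (u : MvPolynomial (Fin n) ℂ) (k : ℕ) :
    complexity (u ^ k) ≤ k * (complexity u + 1) := by
  induction k with
  | zero =>
    have h1 : complexity (1 : MvPolynomial (Fin n) ℂ) = 0 := by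
      simpa using complexity_C_holds (σ := Fin n) (1 : ℂ)
    rw [pow_zero, h1]
    exact Nat.zero_le _
  | succ k ih =>
    rw [pow_succ]
    calc complexity (u ^ k * u) ≤ complexity (u ^ k) + complexity u + 1 :=
          complexity_mul_le_holds _ _
      _ ≤ k * (complexity u + 1) + complexity u + 1 := by omega
      _ = (k + 1) * (complexity u + 1) := by ring

/-- `L(1 + x₁ + ⋯ + x_n) ≤ n + 1`: variables and constants are free, `n` addition gates for the
sum of the variables and one more for the constant. [cite: Burgisser2000, §2.1] -/
theorem complexity_linearForm_le :
    complexity (1 + ∑ i : Fin n, X i : MvPolynomial (Fin n) ℂ) ≤ n + 1 := by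
  have hsum : complexity (∑ i : Fin n, (X i : MvPolynomial (Fin n) ℂ)) ≤ n := by
    calc complexity (∑ i : Fin n, (X i : MvPolynomial (Fin n) ℂ))
        ≤ ∑ i : Fin n, complexity (X i : MvPolynomial (Fin n) ℂ) +
            (Finset.univ : Finset (Fin n)).card := complexity_finset_sum_le _ _
      _ = n := by
          rw [Finset.sum_eq_zero (fun i _ => complexity_X_holds i), Finset.card_univ,
            Fintype.card_fin, zero_add]
  have hone : complexity (1 : MvPolynomial (Fin n) ℂ) = 0 := by
    simpa using complexity_C_holds (σ := Fin n) (1 : ℂ)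
  calc complexity (1 + ∑ i : Fin n, X i : MvPolynomial (Fin n) ℂ)
      ≤ complexity (1 : MvPolynomial (Fin n) ℂ) +
          complexity (∑ i : Fin n, (X i : MvPolynomial (Fin n) ℂ)) + 1 :=
        complexity_add_le_holds _ _
    _ ≤ 0 + n + 1 := by rw [hone]; omega
    _ = n + 1 := by ring

/-- `L((1 + x₁ + ⋯ + x_n)^n) ≤ n (n + 2) ≤ n³` for `n ≥ 2`. [cite: Burgisser2000, §2.1] -/
theorem complexity_linearForm_pow_le (hn : 2 ≤ n) :
    complexity ((1 + ∑ i : Fin n, X i : MvPolynomial (Fin n) ℂ) ^ n) ≤ n ^ 3 := by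
  calc complexity ((1 + ∑ i : Fin n, X i : MvPolynomial (Fin n) ℂ) ^ n)
      ≤ n * (complexity (1 + ∑ i : Fin n, X i : MvPolynomial (Fin n) ℂ) + 1) :=
        complexity_pow_le _ _
    _ ≤ n * (n + 1 + 1) := Nat.mul_le_mul_left n (Nat.add_le_add_right complexity_linearForm_le 1)
    _ ≤ n * (n * n) := Nat.mul_le_mul_left n (by nlinarith)
    _ = n ^ 3 := by ring

end Complexity

section Coefficients

variable {n : ℕ}

/-- Induction step for the positivity of the multinomial coefficients: if every coefficient of `P`
at degree `≤ k` is `≥ 1`, then so is every coefficient of `P · (1 + x₁ + ⋯ + x_n)` at degree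
`≤ k + 1` (over `ℕ`): `coeff_m (P x_i) = coeff_{m - e_i} P` for `i ∈ supp m`. [folklore] -/
theorem one_le_coeff_mul_linearForm {k : ℕ} {P : MvPolynomial (Fin n) ℕ}
    (hP : ∀ m : Fin n →₀ ℕ, m.degree ≤ k → 1 ≤ coeff m P) (m : Fin n →₀ ℕ)
    (hm : m.degree ≤ k + 1) : 1 ≤ coeff m (P * (1 + ∑ i : Fin n, X i)) := by
  rw [mul_add, mul_one, Finset.mul_sum, coeff_add, coeff_sum]
  simp_rw [coeff_mul_X']
  by_cases hmk : m.degree ≤ k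
  · exact (hP m hmk).trans (Nat.le_add_right _ _)
  · have hdeg : m.degree = k + 1 := by omega
    have hm0 : m ≠ 0 := by
      intro h
      rw [h, map_zero] at hdeg
      omega
    obtain ⟨i, hi⟩ : m.support.Nonempty := Finsupp.support_nonempty_iff.mpr hm0
    have hle : Finsupp.single i 1 ≤ m :=
      Finsupp.single_le_iff.mpr (Nat.one_le_iff_ne_zero.mpr (Finsupp.mem_support_iff.mp hi))
    have hdeg' : (m - Finsupp.single i 1).degree ≤ k := by
      have h := map_add Finsupp.degree (m - Finsupp.single i 1) (Finsupp.single i 1)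
      rw [tsub_add_cancel_of_le hle, Finsupp.degree_single, hdeg] at h
      omega
    calc 1 ≤ (if i ∈ m.support then coeff (m - Finsupp.single i 1) P else 0) := by
          rw [if_pos hi]
          exact hP _ hdeg'
      _ ≤ ∑ j : Fin n, (if j ∈ m.support then coeff (m - Finsupp.single j 1) P else 0) :=
          Finset.single_le_sum
            (f := fun j => if j ∈ m.support then coeff (m - Finsupp.single j 1) P else 0)
            (fun j _ => Nat.zero_le _) (Finset.mem_univ i)
      _ ≤ coeff m P +
            ∑ j : Fin n, (if j ∈ m.support then coeff (m - Finsupp.single j 1) P else 0) :=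
          Nat.le_add_left _ _

/-- Over `ℕ`, every coefficient of `(1 + x₁ + ⋯ + x_n)^k` at a monomial of degree `≤ k` is `≥ 1`
(it is the multinomial `k! / (m! (k - |m|)!)`). [folklore] -/
theorem one_le_coeff_linearForm_pow_nat :
    ∀ (k : ℕ) (m : Fin n →₀ ℕ), m.degree ≤ k →
      1 ≤ coeff m ((1 + ∑ i : Fin n, X i : MvPolynomial (Fin n) ℕ) ^ k) := by
  intro k
  induction k with
  | zero =>
    intro m hm
    have hm0 : m = 0 := (Finsupp.degree_eq_zero_iff m).mp (Nat.le_zero.mp hm)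
    subst hm0
    rw [pow_zero, coeff_zero_one]
  | succ k ih =>
    intro m hm
    rw [pow_succ]
    exact one_le_coeff_mul_linearForm ih m hm

/-- `(1 + x₁ + ⋯ + x_n)^k` over `ℂ` is the image of the same polynomial over `ℕ`. [folklore] -/
theorem map_linearForm_pow (k : ℕ) :
    MvPolynomial.map (Nat.castRingHom ℂ) ((1 + ∑ i : Fin n, X i : MvPolynomial (Fin n) ℕ) ^ k) =
      (1 + ∑ i : Fin n, X i : MvPolynomial (Fin n) ℂ) ^ k := by
  rw [map_pow, map_add, map_one, map_sum]
  simp_rw [map_X]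

/-- **Full support**: over `ℂ`, every coefficient of `(1 + x₁ + ⋯ + x_n)^k` at a monomial of
degree `≤ k` is nonzero (a positive integer in characteristic zero).
[cite: ForbesShpilkaVolk2018, Construction 29] -/
theorem coeff_linearForm_pow_ne_zero (k : ℕ) (m : Fin n →₀ ℕ) (hm : m.degree ≤ k) :
    coeff m ((1 + ∑ i : Fin n, X i : MvPolynomial (Fin n) ℂ) ^ k) ≠ 0 := by
  rw [← map_linearForm_pow k, coeff_map, eq_natCast, Nat.cast_ne_zero]
  exact Nat.one_le_iff_ne_zero.mp (one_le_coeff_linearForm_pow_nat k m hm)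

end Coefficients

end FullSupport

open FullSupport

/-- **Registered stub `stub_fullSupport`** (crux stmt-ValiantsHypothesis-14610, line `registered`;
a full-support small circuit, FSV's shift vector of Construction 29 in regime `d = n`): for
`n ≥ 2` the polynomial `f₀ = (1 + x₁ + ⋯ + x_n)^n` has degree `≤ n`, fan-in-two size
`≤ n (n + 2) ≤ n³`, and ALL its `C(2n,n)` coefficients at monomials of degree `≤ n` nonzero.
[cite: ForbesShpilkaVolk2018, Construction 29] -/
theorem stub_fullSupport :
    ∀ n : ℕ, 2 ≤ n → ∃ f₀ ∈ SmallCircuits ℂ n 3,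
      ∀ m : degLEMonomials n, MvPolynomial.coeff (m : Fin n →₀ ℕ) f₀ ≠ 0 := by
  intro n hn
  refine ⟨(1 + ∑ i : Fin n, X i) ^ n,
    ⟨totalDegree_linearForm_pow_le n, complexity_linearForm_pow_le hn⟩, fun m => ?_⟩
  have hm : (m : Fin n →₀ ℕ).degree ≤ n := m.2
  exact coeff_linearForm_pow_ne_zero (n := n) n (m : Fin n →₀ ℕ) hm

end Summit.ValiantsHypothesis.ValiantsHypothesis.Theorems.BarrierLever.SuccinctHittingSetsForVP
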